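import Summits.HubbardSuperconductivity.HubbardSuperconductivity.Theorems.AnisotropyChordTransferFibre3Hole2L31a
import Summits.HubbardSuperconductivity.HubbardSuperconductivity.Theorems.AnisotropyChordTransferFibre3Hole2L31b
import Summits.HubbardSuperconductivity.HubbardSuperconductivity.Theorems.AnisotropyChordTransferFibre3Hole2L31c
import Summits.HubbardSuperconductivity.HubbardSuperconductivity.Theorems.AnisotropyChordTransferFibre3Hole2L31d
import Summits.HubbardSuperconductivity.HubbardSuperconductivity.Theorems.AnisotropyChordTransferFibre3Hole2Cover

/-!
# Route `AnisotropyChord` / H0 rotor rung: ★ HOLE₂(.75) AT `L = 31` — `TwoHoleGap 31 (3/4·eps1 31)`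

The one-body spectral input of the GM₃ assembly `gm3_of_hole2` (p1 g23) at side length `L = 31`: the Neumann gap of the rate-½ walk
on the `31 × 31` torus with ANY two vertices deleted is at least `¾ε₁(31)`.  Assembly of the kernel facts `checkRepsQ_31a…`
(`…Hole2L31a…`, 4 part(s), the 135 `D₄`-classes `repList 31` = `0 ≤ y ≤ x ≤ 15`) via `checkRepsQ_append`, the identification of
the parts with `repList 31` (`decide`), and `Hole2.twoHoleGap_of_checkRepsQ_repList` (`…Fibre3Hole2Cover`: `D₄`-coverage for every `L`;
soundness `…Fibre3Hole2Quarter`, p2's PROP BS, p1's reductions).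
Prover seat `hubbard-h0-rotor-p3` g3; helper for stmt-HubbardSuperconductivity-19089 (`--supports`, helper class).
WHAT THIS IS NOT: nothing here proves superconductivity in the Hubbard model (rotor TARGET as worded stays FALSE, g15 verdict); this
discharges, at ONE side length, ONE hypothesis (HOLE₂(.75)) of ONE conditional reduction (rung 19089). Tree imports only; no sorry.
-/

set_option linter.dupNamespace false
set_option autoImplicit false

namespace Summit.HubbardSuperconductivity.HubbardSuperconductivity.Theorems.AnisotropyChord.Transfer.Fibre3

namespace Hole2

/-- the kernel-fact parts list exactly `repList 31`. [folklore] -/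
theorem repList_31_eq : repList 31 = reps31a ++ reps31b ++ reps31c ++ reps31d := by
  decide +kernel

/-- every representative separation of the `31 × 31` torus passes the kernel check. [folklore] -/
theorem checkRepsQ_repList_31 : checkRepsQ 31 (repList 31) = true := by
  rw [repList_31_eq]
  exact checkRepsQ_append (checkRepsQ_append (checkRepsQ_append (checkRepsQ_31a) checkRepsQ_31b) checkRepsQ_31c) checkRepsQ_31d

/-- ★★★ HOLE₂(.75) AT `L = 31`: `TwoHoleGap 31 (3/4 * eps1 31)`, the spectral hypothesis of `gm3_of_hole2` at `L = 31`. [folklore] -/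
theorem twoHoleGap_thirtyOne : TwoHoleGap 31 (3 / 4 * eps1 31) :=
  twoHoleGap_of_checkRepsQ_repList 31 checkRepsQ_repList_31

end Hole2

end Summit.HubbardSuperconductivity.HubbardSuperconductivity.Theorems.AnisotropyChord.Transfer.Fibre3
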